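import Literature.AlgebraicGeometry.HodgeTheory.GysinFormalism
import Literature.AlgebraicGeometry.Motives.ComplexPointsEhresmann
import Literature.AlgebraicGeometry.Motives.AlgPointsProductProofs
import Literature.AlgebraicTopology.SingularHomology.LerayHirschGlobal
import Literature.AlgebraicTopology.SingularHomology.ProductWithContractible
import HarnessLib

/-!
# Cohomology of a bundle with contractible fibres, and classes on a completed line bundle off a section

Family `hodge`, layer `Literature/AlgebraicGeometry/HodgeTheory`. Theorem-only file (no
definition, no named fact, sorry-free). Two elementary consequences of the local-to-global
Leray–Hirsch theorem of the tree (`LerayHirsch.bijective_of_cover`, Husemoller, *Fibre Bundles*,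
Ch. 17 §1 Thm. 1.1) used in the cohomology of the exceptional divisor of a blow-up along a
codimension-`2` centre (Shioda–Katsura, *On Fermat varieties*, Tôhoku Math. J. 31 (1979), §2
Lemma 2.1: "`H(E) ≅ H(Y) ⊕ H(Y)(-1)` for the `ℙ¹`-bundle `E → Y`"; Voisin, *Hodge Theory and Complex
Algebraic Geometry I*, Lemma 7.32):

* `bijective_map_of_trivial_contractible_fibre` — **a map `p : X → B` onto a paracompact Hausdorff
  base which is, over the members of an open cover, homeomorphic over the base to the projection
  `U × F → U` with `F` contractible, induces isomorphisms `p^* : Hᵏ(B; R) ≅ Hᵏ(X; R)`** (the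
  Leray–Hirsch theorem with the single class `1 ∈ H⁰(X)`: over every open `W` of a member of the
  cover, `p⁻¹W ≃ W × F → W` is a homotopy equivalence, `ProductWithContractible.map_fst_bijective`);
* `exists_restrictCompl_sub_map_eq_zero_of_trivial_affine_complement` — **classes on a completed
  line bundle off the section at infinity**: for `ℂ`-morphisms `π : E → P`, a closed subscheme
  `σ : P → E` and an open immersion `u : E° ↪ E` onto the complement of `σ(P)` such that
  `ρ = π ∘ u : E°(ℂ) → P(ℂ)` is locally (over an open cover of `P(ℂ)`) a product with a
  contractible fibre, every class `e ∈ Hᵃ(E(ℂ); ℂ)` agrees OFF `σ(P)(ℂ)` with a class `π^* p`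
  pulled back from the base: `(e - π^*p)|_{(E ∖ σ(P))(ℂ)} = 0` (take `p = (ρ^*)⁻¹(u^* e)`). This is
  the form in which the `𝔸¹`-bundle `E_t ∖ σ_t(P) → P` of an exceptional divisor
  `E_t = ℙ(𝒪(1) ⊕ 𝒪) → P` enters `FermatHodgeClassesLiftToCurvePowersSum_of_blowupGeometry₃`;
* `exists_trivialisation_of_iso_prod_affineSpace` — a Zariski-local product structure
  `ρ⁻¹V ≅ V ×_ℂ 𝔸¹` over an open `V ⊆ P` gives a topological trivialisation of `ρ(ℂ)` over
  `V(ℂ) = {Q | pt Q ∈ V}` with fibre `ℂ¹` (complex points commute with products and open subschemes,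
  `AlgPoints.prodEquiv`, `AlgPoints.isOpenEmbedding_map_holds`; `𝔸¹(ℂ) = ℂ¹`,
  `ComplexPoints.affineHomeomorph`);
* `exists_iso_prod_affineSpace_of_polynomial_chart` — **a polynomial chart is a product with the
  affine line**: for affine `V ⊆ P` with affine preimage and a ring isomorphism
  `Γ(E°, ρ⁻¹V) ≅ Γ(P, V)[X]` over `Γ(P, V)`, `ρ⁻¹V ≅ V ×_ℂ 𝔸¹_ℂ` over `V` (the morphism `(ρ|, t)`,
  `t` the image of `X`, Mathlib `AffineSpace.homOfVector`; inverse `Spec` of the ring map,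
  `ΓSpec.adjunction`; Hartshorne II Prop. 2.3, Ex. 2.4);
* `exists_restrictCompl_sub_map_eq_zero_of_polynomial_charts` — the algebraic form of the second
  item: it suffices that every point of `P` has an affine neighbourhood over which `E ∖ σ(P)` is
  such a polynomial chart.

## References

* D. Husemoller, *Fibre Bundles*, 3rd ed., GTM 20 (1994), Ch. 17 §1 Thm. 1.1. [HusemollerFibreBundles1994]
* A. Hatcher, *Algebraic Topology* (2002), §3.1 p. 201, §4.D Thm. 4D.1. [HatcherAT2002]
* R. Hartshorne, *Algebraic Geometry* (1977), II Prop. 2.3, II Ex. 2.4. [Hartshorne1977]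
* J.-P. Serre, GAGA, Ann. Inst. Fourier 6 (1956), §2 n°5. [SerreGAGA1956]
* T. Shioda, T. Katsura, On Fermat varieties, Tôhoku Math. J. 31 (1979), §2 Lemma 2.1. [ShiodaKatsura1979]
* C. Voisin, *Hodge Theory and Complex Algebraic Geometry I* (2002), Lemma 7.32. [VoisinHodgeI2002]
-/

noncomputable section

open CategoryTheory AlgebraicGeometry Function Set
open Literature.AlgebraicTopology.SingularHomology
open Literature.AlgebraicTopology.SingularHomology.LerayHirsch

namespace Literature.AlgebraicGeometry.HodgeTheory

universe u

/-! ### The Leray–Hirsch theorem with the single class `1`: bundles with contractible fibre -/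

section Topology

variable (R : Type u) [CommRing R]

/-- For the one-element family of classes `1 ∈ H⁰(X')`, the Leray–Hirsch comparison map in
degree `k` is `a ↦ q^* a ⌣ 1 = q^* a`; hence it is bijective iff `q^*` is. [folklore] -/
theorem bijective_lhMap_one_iff {X' B' : Type u} [TopologicalSpace X'] [TopologicalSpace B']
    (q : C(X', B')) (k : ℕ) :
    Bijective (lhMap R (fun _ : PUnit.{1} ↦ 0) q (fun _ ↦ singularCohomology.one R X') k) ↔
      Bijective (singularCohomology.map R R q k) := by
  classical
  set d : PUnit.{1} → ℕ := fun _ ↦ 0 with hd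
  let j₀ : Idx d k := ⟨PUnit.unit, Nat.zero_le k⟩
  haveI : Unique (Idx d k) :=
    { default := j₀
      uniq := fun j ↦ Subtype.ext (Subsingleton.elim _ _) }
  -- evaluation at the unique index
  let ev : Src R d B' k → singularCohomology R R B' (k - 0) := fun a ↦ a j₀
  have hev : Bijective ev := by
    refine ⟨fun a b h ↦ funext fun j ↦ ?_, fun x ↦ ⟨fun _ ↦ x, rfl⟩⟩
    obtain rfl : j = j₀ := Unique.eq_default j
    exact h
  have hcup : ∀ (x : singularCohomology R R X' (k - 0)) (h : k - 0 + 0 = k),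
      cupProduct h x (singularCohomology.one R X') = x := fun x h ↦ cupProduct_one x
  have hlh : (lhMap R d q (fun _ ↦ singularCohomology.one R X') k : Src R d B' k → _) =
      (singularCohomology.map R R q (k - 0) : _ → _) ∘ ev := by
    funext a
    rw [lhMap_apply, Fintype.sum_unique]
    change (if h : d PUnit.unit ≤ k then _ else 0) = _
    rw [dif_pos (Nat.zero_le k)]
    exact hcup _ _
  change Bijective (lhMap R d q (fun _ ↦ singularCohomology.one R X') k : Src R d B' k → _) ↔ _
  rw [hlh]
  exact Bijective.of_comp_iff _ hev

/-- Restricting a trivialisation over a smaller open subset of the base. [folklore] -/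
theorem exists_trivialisation_restrict {X B F : Type u} [TopologicalSpace X] [TopologicalSpace B]
    [TopologicalSpace F] (p : C(X, B)) {U W : Set B} (hWU : W ⊆ U)
    (φ : ↥(p ⁻¹' U) ≃ₜ ↥U × F) (hφ : ∀ x, ((φ x).1 : B) = p x) :
    ∃ ψ : ↥(p ⁻¹' W) ≃ₜ ↥W × F, ∀ x, ((ψ x).1 : B) = p x := by
  have hsymm : ∀ y : ↥U × F, p (φ.symm y).1 = y.1 := fun y ↦ by
    have h := hφ (φ.symm y)
    rw [φ.apply_symm_apply] at h
    exact h.symm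
  have hmem : ∀ y : ↥W × F, (φ.symm (⟨y.1.1, hWU y.1.2⟩, y.2)).1 ∈ p ⁻¹' W := fun y ↦ by
    change p _ ∈ W
    rw [hsymm]
    exact y.1.2
  refine ⟨{ toFun := fun x ↦ (⟨p x.1, x.2⟩, (φ ⟨x.1, hWU x.2⟩).2)
            invFun := fun y ↦ ⟨(φ.symm (⟨y.1.1, hWU y.1.2⟩, y.2)).1, hmem y⟩
            left_inv := fun x ↦ by
              apply Subtype.ext
              have h1 : (⟨p x.1, hWU x.2⟩, (φ ⟨x.1, hWU x.2⟩).2) = φ ⟨x.1, hWU x.2⟩ :=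
                Prod.ext (Subtype.ext (hφ ⟨x.1, hWU x.2⟩).symm) rfl
              change (φ.symm (⟨p x.1, hWU x.2⟩, (φ ⟨x.1, hWU x.2⟩).2)).1 = x.1
              rw [h1, φ.symm_apply_apply]
            right_inv := fun y ↦ by
              refine Prod.ext (Subtype.ext (hsymm _)) ?_
              change (φ ⟨(φ.symm (⟨y.1.1, hWU y.1.2⟩, y.2)).1, _⟩).2 = y.2
              rw [Subtype.coe_eta, φ.apply_symm_apply]
            continuous_toFun := by
              refine Continuous.prodMk ?_ ?_
              · exact (p.continuous.comp continuous_subtype_val).subtype_mk _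
              · exact continuous_snd.comp (φ.continuous.comp (continuous_subtype_val.subtype_mk _))
            continuous_invFun :=
              (continuous_subtype_val.comp (φ.symm.continuous.comp
                (((continuous_subtype_val.comp continuous_fst).subtype_mk fun y ↦ hWU y.1.2).prodMk
                  continuous_snd))).subtype_mk hmem }, fun x ↦ rfl⟩

/-- **Bundles with contractible fibre have `p^*` bijective.** Let `p : X → B` be a continuous map
onto a paracompact Hausdorff space which is locally trivial with a contractible non-empty fibre
`F`: over the members `U a` of an open cover of `B` there are homeomorphisms
`p⁻¹(U a) ≃ U a × F` over `U a`. Then `p^* : Hᵏ(B; R) → Hᵏ(X; R)` is bijective for every `k`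
(Leray–Hirsch with the single class `1`; over each open `W ⊆ U a` the restricted bundle is
`W × F → W`, a homotopy equivalence). [cite: HusemollerFibreBundles1994, Ch. 17 §1 Thm. 1.1]
[cite: HatcherAT2002, §3.1 p. 201 and §4.D Thm. 4D.1] -/
theorem bijective_map_of_trivial_contractible_fibre {X B F : Type u} [TopologicalSpace X]
    [TopologicalSpace B] [TopologicalSpace F] [T2Space B] [ParacompactSpace B]
    [ContractibleSpace F] [Nonempty F] (p : C(X, B)) {α : Type*} (U : α → Set B)
    (hUo : ∀ a, IsOpen (U a)) (hU : ⋃ a, U a = univ) (φ : ∀ a, ↥(p ⁻¹' U a) ≃ₜ ↥(U a) × F)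
    (hφ : ∀ a x, ((φ a x).1 : B) = p x) (k : ℕ) :
    Bijective (singularCohomology.map R R p k) := by
  classical
  set d : PUnit.{1} → ℕ := fun _ ↦ 0 with hd
  set c : (j : PUnit.{1}) → singularCohomology R R X (d j) := fun _ ↦ singularCohomology.one R X
    with hc
  -- the hereditary local condition: over an open `W ⊆ U a`, `p⁻¹W ≃ W × F → W`
  have hloc : ∀ (a : α) (W : Set B), IsOpen W → W ⊆ U a → IsLH R d p c W := by
    intro a W _ hWU n
    have hcls : resCls p W c = fun _ ↦ singularCohomology.one R ↥(p ⁻¹' W) := by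
      funext j
      exact singularCohomology.map_one _
    rw [hcls, bijective_lhMap_one_iff]
    -- `resMap p W = fst ∘ ψ`
    obtain ⟨ψ, hψ⟩ := exists_trivialisation_restrict p hWU (φ a) (hφ a)
    have hfac : (resMap p W : C(↥(p ⁻¹' W), ↥W)) =
        (ContinuousMap.fst : C(↥W × F, ↥W)).comp (ψ : C(↥(p ⁻¹' W), ↥W × F)) := by
      refine ContinuousMap.ext fun x ↦ Subtype.ext ?_
      exact (hψ x).symm
    rw [hfac, singularCohomology.map_comp]
    exact (singularCohomology.mapIso R R ψ n).toLinearEquiv.bijective.comp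
      (map_fst_bijective (R := R) (M := R) (U := ↥W) (C := F) n)
  have h := bijective_of_cover R d p c U hUo hU hloc k
  exact (bijective_lhMap_one_iff R p k).mp h

end Topology


/-! ### From a Zariski-local product structure to a topological trivialisation -/

section Product

open Literature.AlgebraicGeometry.Motives Literature.NumberTheory.Transcendental MonoidalCategory

variable {P Eo : Motives.SchemeOver ℂ}

/-- The open immersion `O ↪ X` underlying `openSubschemeOverι`. [folklore] -/
theorem isOpenImmersion_openSubschemeOverι_left (X : Motives.SchemeOver ℂ) (O : X.left.Opens) :
    IsOpenImmersion (openSubschemeOverι X O).left :=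
  inferInstanceAs (IsOpenImmersion O.ι)

/-- The image of `(O ↪ X)(ℂ)` is `{Q | pt Q ∈ O}`. [folklore] -/
theorem range_map_openSubschemeOverι (X : Motives.SchemeOver ℂ) (O : X.left.Opens) :
    Set.range (AlgPoints.map (L := ℂ) (openSubschemeOverι X O)) = {Q : ComplexPoints X | Q.pt ∈ O} := by
  haveI := isOpenImmersion_openSubschemeOverι_left X O
  rw [AlgPoints.range_map_of_isOpenImmersion_holds]
  ext Q
  change Q.pt ∈ (O.ι.opensRange : Set X.left) ↔ Q.pt ∈ (O : Set X.left)
  rw [Scheme.Opens.opensRange_ι]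

/-- The complex points of an open subscheme `O ⊆ X` form the open subspace `{Q | pt Q ∈ O}` of
`X(ℂ)`: a homeomorphism over the inclusion (`AlgPoints.isOpenEmbedding_map_holds`,
`AlgPoints.range_map_of_isOpenImmersion_holds`). [folklore] -/
theorem exists_pointsOpenSubschemeHomeomorph (X : Motives.SchemeOver ℂ) (O : X.left.Opens) :
    ∃ θ : ComplexPoints (openSubschemeOver X O) ≃ₜ ↥{Q : ComplexPoints X | Q.pt ∈ O},
      ∀ Q, ((θ Q : ↥{Q : ComplexPoints X | Q.pt ∈ O}) : ComplexPoints X) =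
        AlgPoints.map (openSubschemeOverι X O) Q := by
  haveI := isOpenImmersion_openSubschemeOverι_left X O
  exact ⟨(AlgPoints.isOpenEmbedding_map_holds (L := ℂ) (openSubschemeOverι X O)).isEmbedding.toHomeomorph.trans
    (Homeomorph.setCongr (range_map_openSubschemeOverι X O)), fun Q ↦ rfl⟩

/-- **A Zariski-local product structure gives a topological trivialisation.** If over an open
`V ⊆ P` the `ℂ`-scheme `ρ⁻¹V` is isomorphic over `V` to `V × 𝔸¹`, then over the open subset
`V(ℂ) = {Q | pt Q ∈ V}` of `P(ℂ)` the map `ρ(ℂ)` is homeomorphic over the base to the projection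
`V(ℂ) × ℂ¹ → V(ℂ)` (complex points commute with products and open subschemes; `𝔸¹(ℂ) = ℂ¹`,
`ComplexPoints.affineHomeomorph`). [cite: SerreGAGA1956, §2 n°5] -/
theorem exists_trivialisation_of_iso_prod_affineSpace (ρ : Eo ⟶ P) (V : P.left.Opens)
    (ε : openSubschemeOver Eo (ρ.left ⁻¹ᵁ V) ≅ openSubschemeOver P V ⊗ affineSpaceOver (Fin 1) ℂ)
    (hε : ε.hom ≫ CartesianMonoidalCategory.fst _ _ = restrictOverHom ρ V) :
    ∃ φ : ↥((AlgPoints.mapContinuous (L := ℂ) ρ) ⁻¹' {Q : ComplexPoints P | Q.pt ∈ V}) ≃ₜ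
        ↥{Q : ComplexPoints P | Q.pt ∈ V} × (Fin 1 → ℂ),
      ∀ x, ((φ x).1 : ComplexPoints P) = AlgPoints.mapContinuous (L := ℂ) ρ x := by
  -- the open pieces
  have hpre : (AlgPoints.mapContinuous (L := ℂ) ρ) ⁻¹' {Q : ComplexPoints P | Q.pt ∈ V} =
      {Q' : ComplexPoints Eo | Q'.pt ∈ ρ.left ⁻¹ᵁ V} := by
    ext Q'
    rfl
  obtain ⟨θO', hθO'⟩ := exists_pointsOpenSubschemeHomeomorph Eo (ρ.left ⁻¹ᵁ V)
  let θO : ComplexPoints (openSubschemeOver Eo (ρ.left ⁻¹ᵁ V)) ≃ₜ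
      ↥((AlgPoints.mapContinuous (L := ℂ) ρ) ⁻¹' {Q : ComplexPoints P | Q.pt ∈ V}) :=
    θO'.trans (Homeomorph.setCongr hpre.symm)
  have hθO : ∀ Q, ((θO Q : ↥((AlgPoints.mapContinuous (L := ℂ) ρ) ⁻¹' _)) : ComplexPoints Eo) =
      AlgPoints.map (openSubschemeOverι Eo (ρ.left ⁻¹ᵁ V)) Q := hθO'
  obtain ⟨θV, hθV⟩ := exists_pointsOpenSubschemeHomeomorph P V
  -- points along the isomorphism and the product decomposition
  let θε : ComplexPoints (openSubschemeOver Eo (ρ.left ⁻¹ᵁ V)) ≃ₜ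
      ComplexPoints (openSubschemeOver P V ⊗ affineSpaceOver (Fin 1) ℂ) :=
    { toFun := AlgPoints.map ε.hom
      invFun := AlgPoints.map ε.inv
      left_inv := fun Q ↦ by
        change AlgPoints.map ε.inv (AlgPoints.map ε.hom Q) = Q
        rw [← AlgPoints.map_comp_apply, ε.hom_inv_id, AlgPoints.map_id_apply]
      right_inv := fun Q ↦ by
        change AlgPoints.map ε.hom (AlgPoints.map ε.inv Q) = Q
        rw [← AlgPoints.map_comp_apply, ε.inv_hom_id, AlgPoints.map_id_apply]
      continuous_toFun := AlgPoints.continuous_map ε.hom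
      continuous_invFun := AlgPoints.continuous_map ε.inv }
  let θP : ComplexPoints (openSubschemeOver P V ⊗ affineSpaceOver (Fin 1) ℂ) ≃ₜ
      ComplexPoints (openSubschemeOver P V) × ComplexPoints (affineSpaceOver (Fin 1) ℂ) :=
    { toEquiv := AlgPoints.prodEquiv
      continuous_toFun := AlgPoints.continuous_prodEquiv
      continuous_invFun := AlgPoints.continuous_prodEquiv_symm }
  let φ : ↥((AlgPoints.mapContinuous (L := ℂ) ρ) ⁻¹' {Q : ComplexPoints P | Q.pt ∈ V}) ≃ₜ
      ↥{Q : ComplexPoints P | Q.pt ∈ V} × (Fin 1 → ℂ) :=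
    θO.symm.trans (θε.trans (θP.trans (θV.prodCongr (ComplexPoints.affineHomeomorph 1).symm)))
  refine ⟨φ, fun x ↦ ?_⟩
  obtain ⟨Q', rfl⟩ := θO.surjective x
  change ((θV (AlgPoints.prodEquiv (AlgPoints.map ε.hom (θO.symm (θO Q')))).1 :
      ↥{Q : ComplexPoints P | Q.pt ∈ V}) : ComplexPoints P) = AlgPoints.map ρ ((θO Q').1)
  rw [θO.symm_apply_apply, AlgPoints.prodEquiv_apply_fst, hθV, hθO]
  rw [← AlgPoints.map_comp_apply, ← AlgPoints.map_comp_apply, ← AlgPoints.map_comp_apply,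
    ← Category.assoc, hε, restrictOverHom_comp_openSubschemeOverι]

end Product


/-! ### From a polynomial chart `Γ(ρ⁻¹V) ≅ Γ(V)[X]` to the product structure `ρ⁻¹V ≅ V × 𝔸¹` -/

section PolynomialChart

open Literature.AlgebraicGeometry.Motives Literature.NumberTheory.Transcendental MonoidalCategory
  Opposite Polynomial

variable {P Eo : Motives.SchemeOver ℂ}

/-- **A polynomial chart is a product with the affine line.** Let `ρ : E° → P` be a morphism of
`ℂ`-schemes, `V ⊆ P` an affine open with affine preimage `ρ⁻¹V`, and
`e : Γ(E°, ρ⁻¹V) ≅ Γ(P, V)[X]` a ring isomorphism under which `ρ^* : Γ(P, V) → Γ(E°, ρ⁻¹V)`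
becomes the inclusion of constants. Then `ρ⁻¹V ≅ V ×_ℂ 𝔸¹_ℂ` over `V` (as `ℂ`-schemes): the
morphism `(ρ|, t) : ρ⁻¹V → V × 𝔸¹`, `t = e⁻¹(X)`, with inverse `Spec` of
`Γ(E°, ρ⁻¹V) ≅ Γ(P, V)[X] → Γ(V × 𝔸¹)`, `X ↦` the coordinate (Hartshorne II Ex. 2.4 / Prop. 2.3:
morphisms into an affine scheme are ring maps out of its coordinate ring; `𝔸ⁿ` represents
`n`-tuples of global functions, Mathlib `AffineSpace.homOfVector`).
[cite: Hartshorne1977, II Prop. 2.3 and Ex. 2.4] -/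
theorem exists_iso_prod_affineSpace_of_polynomial_chart (ρ : Eo ⟶ P) (V : P.left.Opens)
    (hV : IsAffineOpen V) (hO : IsAffineOpen (ρ.left ⁻¹ᵁ V))
    (e : Γ(Eo.left, ρ.left ⁻¹ᵁ V) ≃+* (Γ(P.left, V))[X])
    (he : ∀ s, e (ρ.left.appLE V (ρ.left ⁻¹ᵁ V) le_rfl s) = Polynomial.C s) :
    ∃ ε : openSubschemeOver Eo (ρ.left ⁻¹ᵁ V) ≅ openSubschemeOver P V ⊗ affineSpaceOver (Fin 1) ℂ,
      ε.hom ≫ CartesianMonoidalCategory.fst _ _ = restrictOverHom ρ V := by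
  haveI : IsAffine (ρ.left ⁻¹ᵁ V : Scheme) := hO
  haveI : IsAffine (V : Scheme) := hV
  let OO : Motives.SchemeOver ℂ := openSubschemeOver Eo (ρ.left ⁻¹ᵁ V)
  let VV : Motives.SchemeOver ℂ := openSubschemeOver P V
  let AA : Motives.SchemeOver ℂ := affineSpaceOver (Fin 1) ℂ
  haveI : IsAffine OO.left := hO
  haveI : IsAffine VV.left := hV
  let g₁ : OO ⟶ VV := restrictOverHom ρ V
  -- the restriction of `ρ` on global sections
  have happ : g₁.left.appTop =
      V.topIso.hom ≫ ρ.left.appLE V (ρ.left ⁻¹ᵁ V) le_rfl ≫ (ρ.left ⁻¹ᵁ V).topIso.inv := by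
    change (ρ.left ∣_ V).appTop = _
    rw [← Scheme.Hom.resLE_eq_morphismRestrict]
    exact Scheme.Hom.resLE_app_top ρ.left (le_rfl : ρ.left ⁻¹ᵁ V ≤ ρ.left ⁻¹ᵁ V)
  have he' : ∀ a, e.symm (C a) = ρ.left.appLE V (ρ.left ⁻¹ᵁ V) le_rfl a := fun a ↦ by
    rw [← he, RingEquiv.symm_apply_apply]
  -- the coordinate `t = e⁻¹(X)` as a global function on `ρ⁻¹V`, and the forward morphism `(ρ|, t)`
  let t' : Γ(OO.left, ⊤) := (ρ.left ⁻¹ᵁ V).topIso.inv (e.symm Polynomial.X)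
  let g₂ : OO ⟶ AA :=
    Over.homMk (AffineSpace.homOfVector OO.hom (fun _ : Fin 1 ↦ t')) (AffineSpace.homOfVector_over _ _)
  let F : OO ⟶ VV ⊗ AA := CartesianMonoidalCategory.lift g₁ g₂
  have hF₁ : F.left ≫ (CartesianMonoidalCategory.fst VV AA).left = g₁.left := by
    change (F ≫ CartesianMonoidalCategory.fst VV AA).left = _
    rw [CartesianMonoidalCategory.lift_fst]
  have hF₂ : F.left ≫ (CartesianMonoidalCategory.snd VV AA).left =
      AffineSpace.homOfVector OO.hom (fun _ : Fin 1 ↦ t') := by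
    change (F ≫ CartesianMonoidalCategory.snd VV AA).left = _
    rw [CartesianMonoidalCategory.lift_snd]
    rfl
  -- the backward ring map `Γ(E°, ρ⁻¹V) ≅ Γ(P, V)[X] → Γ(V × 𝔸¹)`
  let cV : Γ(P.left, V) →+* Γ((VV ⊗ AA).left, ⊤) :=
    ((CartesianMonoidalCategory.fst VV AA).left.appTop).hom.comp V.topIso.inv.hom
  let xA : Γ((VV ⊗ AA).left, ⊤) :=
    (CartesianMonoidalCategory.snd VV AA).left.appTop (AffineSpace.coord (Spec (.of ℂ)) (0 : Fin 1))
  let ψ : (Γ(P.left, V))[X] →+* Γ((VV ⊗ AA).left, ⊤) := Polynomial.eval₂RingHom cV xA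
  let φ : Γ(Eo.left, ρ.left ⁻¹ᵁ V) →+* Γ((VV ⊗ AA).left, ⊤) := ψ.comp e.toRingHom
  have hφC : ∀ a, φ (e.symm (C a)) =
      (CartesianMonoidalCategory.fst VV AA).left.appTop (V.topIso.inv a) := by
    intro a
    change ψ (e (e.symm (C a))) = _
    rw [RingEquiv.apply_symm_apply]
    change Polynomial.eval₂ cV xA (C a) = _
    rw [Polynomial.eval₂_C]
    rfl
  have hφX : φ (e.symm Polynomial.X) = xA := by
    change ψ (e (e.symm X)) = _
    rw [RingEquiv.apply_symm_apply]
    change Polynomial.eval₂ cV xA X = _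
    rw [Polynomial.eval₂_X]
  -- the backward morphism `V × 𝔸¹ → Spec Γ(E°, ρ⁻¹V) ≅ ρ⁻¹V`
  let G₀ : (VV ⊗ AA).left ⟶ Spec Γ(Eo.left, ρ.left ⁻¹ᵁ V) :=
    ΓSpec.adjunction.homEquiv (VV ⊗ AA).left (op Γ(Eo.left, ρ.left ⁻¹ᵁ V)) (CommRingCat.ofHom φ).op
  have hG₀ : (Scheme.ΓSpecIso Γ(Eo.left, ρ.left ⁻¹ᵁ V)).inv ≫ G₀.appTop = CommRingCat.ofHom φ :=
    ΓSpecIso_inv_ΓSpec_adjunction_homEquiv (CommRingCat.ofHom φ)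
  let G : (VV ⊗ AA).left ⟶ OO.left := G₀ ≫ hO.isoSpec.inv
  have hGapp : G.appTop = (ρ.left ⁻¹ᵁ V).topIso.hom ≫ CommRingCat.ofHom φ := by
    change (G₀ ≫ hO.isoSpec.inv).appTop = _
    rw [Scheme.Hom.comp_appTop, IsAffineOpen.isoSpec_inv_appTop, Category.assoc, hG₀]
  have hGapp' : ∀ s, G.appTop s = φ ((ρ.left ⁻¹ᵁ V).topIso.hom s) := fun s ↦ by
    rw [hGapp]
    rfl
  have htop : ∀ s, (ρ.left ⁻¹ᵁ V).topIso.hom ((ρ.left ⁻¹ᵁ V).topIso.inv s) = s := fun s ↦ by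
    rw [← CategoryTheory.comp_apply, Iso.inv_hom_id, CategoryTheory.id_apply]
  have htopV : ∀ s, V.topIso.inv (V.topIso.hom s) = s := fun s ↦ by
    rw [← CategoryTheory.comp_apply, Iso.hom_inv_id, CategoryTheory.id_apply]
  -- `G ≫ ρ| = pr₁`
  have hGfst : G ≫ g₁.left = (CartesianMonoidalCategory.fst VV AA).left := by
    refine ext_of_isAffine (CommRingCat.hom_ext (RingHom.ext fun s ↦ ?_))
    rw [Scheme.Hom.comp_appTop, happ]
    change G.appTop ((ρ.left ⁻¹ᵁ V).topIso.inv
      (ρ.left.appLE V (ρ.left ⁻¹ᵁ V) le_rfl (V.topIso.hom s))) = _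
    rw [hGapp', ← he', htop, hφC, htopV]
  have hOOhom : OO.hom = g₁.left ≫ VV.hom := (Over.w (restrictOverHom ρ V)).symm
  have hGover : G ≫ OO.hom = (VV ⊗ AA).hom := by
    rw [hOOhom, ← Category.assoc, hGfst]
    exact Over.w (CartesianMonoidalCategory.fst VV AA)
  let GOver : VV ⊗ AA ⟶ OO := Over.homMk G hGover
  -- `F ≫ G = 𝟙`: compare the ring endomorphisms of `Γ(ρ⁻¹V) ≅ Γ(P, V)[X]` on `C a` and on `X`
  have hFG : F ≫ GOver = 𝟙 OO := by
    ext1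
    change F.left ≫ G = 𝟙 OO.left
    refine ext_of_isAffine ?_
    rw [Scheme.Hom.comp_appTop, Scheme.Hom.id_appTop]
    have key : F.left.appTop.hom.comp (G.appTop.hom.comp
        ((ρ.left ⁻¹ᵁ V).topIso.inv.hom.comp e.symm.toRingHom)) =
        (ρ.left ⁻¹ᵁ V).topIso.inv.hom.comp e.symm.toRingHom := by
      refine Polynomial.ringHom_ext (fun a ↦ ?_) ?_
      · change F.left.appTop (G.appTop ((ρ.left ⁻¹ᵁ V).topIso.inv (e.symm (C a)))) =
          (ρ.left ⁻¹ᵁ V).topIso.inv (e.symm (C a))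
        rw [hGapp', htop, hφC, ← CategoryTheory.comp_apply, ← Scheme.Hom.comp_appTop, hF₁, happ,
          he']
        change (ρ.left ⁻¹ᵁ V).topIso.inv (ρ.left.appLE V (ρ.left ⁻¹ᵁ V) le_rfl
          (V.topIso.hom (V.topIso.inv a))) = _
        rw [← CategoryTheory.comp_apply V.topIso.inv, Iso.inv_hom_id, CategoryTheory.id_apply]
      · change F.left.appTop (G.appTop ((ρ.left ⁻¹ᵁ V).topIso.inv (e.symm X))) =
          (ρ.left ⁻¹ᵁ V).topIso.inv (e.symm X)
        rw [hGapp', htop, hφX]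
        change F.left.appTop ((CartesianMonoidalCategory.snd VV AA).left.appTop _) = t'
        rw [← CategoryTheory.comp_apply, ← Scheme.Hom.comp_appTop, hF₂]
        exact AffineSpace.homOfVector_appTop_coord (f := OO.hom) (v := fun _ : Fin 1 ↦ t') 0
    refine CommRingCat.hom_ext (RingHom.ext fun s ↦ ?_)
    have hs : s = (ρ.left ⁻¹ᵁ V).topIso.inv (e.symm (e ((ρ.left ⁻¹ᵁ V).topIso.hom s))) := by
      rw [RingEquiv.symm_apply_apply, ← CategoryTheory.comp_apply, Iso.hom_inv_id,
        CategoryTheory.id_apply]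
    change F.left.appTop (G.appTop s) = s
    conv_lhs => rw [hs]
    conv_rhs => rw [hs]
    exact congrArg (fun f : (Γ(P.left, V))[X] →+* Γ(OO.left, ⊤) ↦
      f (e ((ρ.left ⁻¹ᵁ V).topIso.hom s))) key
  -- `G ≫ F = 𝟙`: test against the two projections
  have hGF : GOver ≫ F = 𝟙 (VV ⊗ AA) := by
    refine CartesianMonoidalCategory.hom_ext _ _ ?_ ?_
    · rw [Category.assoc, CartesianMonoidalCategory.lift_fst, Category.id_comp]
      ext1
      exact hGfst
    · rw [Category.assoc, CartesianMonoidalCategory.lift_snd, Category.id_comp]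
      ext1
      change G ≫ AffineSpace.homOfVector OO.hom (fun _ : Fin 1 ↦ t') =
        (CartesianMonoidalCategory.snd VV AA).left
      refine AffineSpace.hom_ext ?_ fun i ↦ ?_
      · rw [Category.assoc, AffineSpace.homOfVector_over, hGover]
        exact (Over.w (CartesianMonoidalCategory.snd VV AA)).symm
      · obtain rfl : i = 0 := Subsingleton.elim _ _
        rw [Scheme.Hom.comp_appTop, CategoryTheory.comp_apply, AffineSpace.homOfVector_appTop_coord,
          hGapp', htop, hφX]
        rfl
  exact ⟨⟨F, GOver, hFG, hGF⟩, CartesianMonoidalCategory.lift_fst g₁ g₂⟩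

end PolynomialChart

/-! ### Classes on `E` off a closed subscheme whose complement is a bundle with contractible fibres -/

section Complement

open Literature.AlgebraicGeometry.Motives

variable {E P Eo : Motives.SchemeOver ℂ}

/-- The complex points of an open immersion `u : E° ↪ E` whose image is the complement of the image
of `σ : P → E` form the open subspace `(E ∖ σ(P))(ℂ)`; transport of the restriction map along the
resulting homeomorphism: a class killed by `u(ℂ)^*` restricts to zero on `(E ∖ σ(P))(ℂ)`.
[folklore] -/
theorem restrictCompl_eq_zero_of_map_eq_zero (σ : P ⟶ E) (u : Eo ⟶ E) [IsOpenImmersion u.left]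
    (hu : Set.range u.left.base = (Set.range σ.left.base)ᶜ) (a : ℕ) (x : complexBetti E a)
    (hx : complexBetti.map u a x = 0) :
    complexBetti.restrictCompl E (Set.range σ.left.base) a x = 0 := by
  set uC : C(ComplexPoints Eo, ComplexPoints E) := AlgPoints.mapContinuous (L := ℂ) u with huC
  have hue : Topology.IsOpenEmbedding uC := AlgPoints.isOpenEmbedding_map_holds u
  have hrange : Set.range uC = {Q : ComplexPoints E | Q.pt ∉ Set.range σ.left.base} := by
    change Set.range (AlgPoints.map u) = _
    rw [AlgPoints.range_map_of_isOpenImmersion_holds u]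
    ext Q
    change Q.pt ∈ (u.left.opensRange : Set E.left) ↔ Q.pt ∉ Set.range σ.left.base
    rw [Scheme.Hom.coe_opensRange, hu]
    rfl
  -- the homeomorphism `E°(ℂ) ≃ (E ∖ σ(P))(ℂ)`
  let θ : ComplexPoints Eo ≃ₜ complexPointsCompl E (Set.range σ.left.base) :=
    hue.isEmbedding.toHomeomorph.trans (Homeomorph.setCongr hrange)
  have hval : (⟨Subtype.val, continuous_subtype_val⟩ :
      C(complexPointsCompl E (Set.range σ.left.base), ComplexPoints E)) =
      uC.comp (θ.symm : C(complexPointsCompl E (Set.range σ.left.base), ComplexPoints Eo)) := by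
    refine ContinuousMap.ext fun Q ↦ ?_
    obtain ⟨Q', rfl⟩ := θ.surjective Q
    change ((θ Q' : complexPointsCompl E _) : ComplexPoints E) = uC (θ.symm (θ Q'))
    rw [θ.symm_apply_apply]
    rfl
  change singularCohomology.map ℂ ℂ (⟨Subtype.val, continuous_subtype_val⟩ :
      C(complexPointsCompl E (Set.range σ.left.base), ComplexPoints E)) a x = 0
  have hx' : (singularCohomology.map ℂ ℂ uC a) x = 0 := hx
  rw [hval, singularCohomology.map_comp, ConcreteCategory.comp_apply, hx', map_zero]

/-- **Classes on `E` off `σ(P)` come from the base when `E ∖ σ(P) → P` is a bundle with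
contractible fibres.** Let `π : E → P`, `σ : P → E`, `u : E° → E` be `ℂ`-morphisms with `u` an open
immersion onto the complement of `σ(P)`, and suppose `P(ℂ)` is compact Hausdorff and
`ρ(ℂ) = (u ≫ π)(ℂ) : E°(ℂ) → P(ℂ)` is trivial with a contractible non-empty fibre `F` over the
members of an open cover of `P(ℂ)`. Then for every `e ∈ Hᵃ(E(ℂ); ℂ)` there is `p ∈ Hᵃ(P(ℂ); ℂ)` with
`(e - π^* p)|_{(E ∖ σ(P))(ℂ)} = 0`: `ρ^*` is bijective
(`bijective_map_of_trivial_contractible_fibre`), `p := (ρ^*)⁻¹(u^* e)`, and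
`u^*(e - π^*p) = u^*e - ρ^*p = 0`. (Shioda–Katsura's `H(E) = H(Y) ⊕ H(Y)(-1)` for the exceptional
`ℙ¹`-bundle, in the form: modulo classes supported on the section at infinity, every class is
pulled back from the base.) [cite: ShiodaKatsura1979, §2 Lemma 2.1] [cite: VoisinHodgeI2002, Lemma 7.32] -/
theorem exists_restrictCompl_sub_map_eq_zero_of_trivial_affine_complement
    [CompactSpace (ComplexPoints P)] [T2Space (ComplexPoints P)]
    (π : E ⟶ P) (σ : P ⟶ E) (u : Eo ⟶ E) [IsOpenImmersion u.left]
    (hu : Set.range u.left.base = (Set.range σ.left.base)ᶜ)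
    {F : Type} [TopologicalSpace F] [ContractibleSpace F] [Nonempty F]
    {α : Type*} (U : α → Set (ComplexPoints P)) (hUo : ∀ i, IsOpen (U i))
    (hU : ⋃ i, U i = univ)
    (φ : ∀ i, ↥((AlgPoints.mapContinuous (L := ℂ) (u ≫ π)) ⁻¹' U i) ≃ₜ ↥(U i) × F)
    (hφ : ∀ i x, ((φ i x).1 : ComplexPoints P) = AlgPoints.mapContinuous (L := ℂ) (u ≫ π) x)
    (a : ℕ) (e : complexBetti E a) :
    ∃ p : complexBetti P a,
      complexBetti.restrictCompl E (Set.range σ.left.base) a (e - complexBetti.map π a p) = 0 := by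
  have hbij := bijective_map_of_trivial_contractible_fibre ℂ
    (AlgPoints.mapContinuous (L := ℂ) (u ≫ π)) U hUo hU φ hφ a
  obtain ⟨p, hp⟩ := hbij.2 (complexBetti.map u a e)
  refine ⟨p, restrictCompl_eq_zero_of_map_eq_zero σ u hu a _ ?_⟩
  have hcomp : AlgPoints.mapContinuous (L := ℂ) (u ≫ π) =
      (AlgPoints.mapContinuous (L := ℂ) π).comp (AlgPoints.mapContinuous (L := ℂ) u) := by
    ext Q : 1
    exact AlgPoints.map_comp_apply u π Q
  rw [map_sub, sub_eq_zero]
  change complexBetti.map u a e =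
    (singularCohomology.map ℂ ℂ (AlgPoints.mapContinuous (L := ℂ) π) a ≫
      singularCohomology.map ℂ ℂ (AlgPoints.mapContinuous (L := ℂ) u) a) p
  rw [← singularCohomology.map_comp, ← hcomp]
  exact hp.symm

/-- **Classes on `E` off `σ(P)` come from the base when `E ∖ σ(P) → P` is Zariski-locally a
polynomial extension** (the algebraic form consumed by the blow-up geometry): `π : E → P`,
`σ : P → E`, `u : E° ↪ E` an open immersion onto the complement of `σ(P)`, `P(ℂ)` compact
Hausdorff, and every point of `P` has an affine open neighbourhood `V` with `ρ⁻¹V` affine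
(`ρ = u ≫ π`) and `Γ(E°, ρ⁻¹V) ≅ Γ(P, V)[X]` over `Γ(P, V)`. Then for every `e ∈ Hᵃ(E(ℂ); ℂ)` there
is `p ∈ Hᵃ(P(ℂ); ℂ)` with `(e - π^*p)|_{(E ∖ σ(P))(ℂ)} = 0`
(`exists_iso_prod_affineSpace_of_polynomial_chart`, `exists_trivialisation_of_iso_prod_affineSpace`,
`exists_restrictCompl_sub_map_eq_zero_of_trivial_affine_complement` with fibre `ℂ¹`).
[cite: ShiodaKatsura1979, §2 Lemma 2.1] [cite: VoisinHodgeI2002, Lemma 7.32] -/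
theorem exists_restrictCompl_sub_map_eq_zero_of_polynomial_charts
    [CompactSpace (ComplexPoints P)] [T2Space (ComplexPoints P)]
    (π : E ⟶ P) (σ : P ⟶ E) (u : Eo ⟶ E) [IsOpenImmersion u.left]
    (hu : Set.range u.left.base = (Set.range σ.left.base)ᶜ)
    (hcharts : ∀ x : P.left, ∃ V : P.left.Opens, x ∈ V ∧ IsAffineOpen V ∧
      ∃ (_ : IsAffineOpen ((u ≫ π).left ⁻¹ᵁ V))
        (e : Γ(Eo.left, (u ≫ π).left ⁻¹ᵁ V) ≃+* Polynomial (Γ(P.left, V))),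
        ∀ s, e ((u ≫ π).left.appLE V ((u ≫ π).left ⁻¹ᵁ V) le_rfl s) = Polynomial.C s)
    (a : ℕ) (e : complexBetti E a) :
    ∃ p : complexBetti P a,
      complexBetti.restrictCompl E (Set.range σ.left.base) a (e - complexBetti.map π a p) = 0 := by
  choose V hxV hV hO ech hech using hcharts
  -- the open cover of `P(ℂ)` and the trivialisations over it
  have hUo : ∀ x : P.left, IsOpen {Q : ComplexPoints P | Q.pt ∈ V x} := fun x ↦
    AlgPoints.isOpen_setOf_pt_mem (V x)
  have hU : ⋃ x : P.left, {Q : ComplexPoints P | Q.pt ∈ V x} = Set.univ :=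
    Set.eq_univ_of_forall fun Q ↦ Set.mem_iUnion.mpr ⟨Q.pt, hxV Q.pt⟩
  have hφ : ∀ x : P.left, ∃ φ : ↥((AlgPoints.mapContinuous (L := ℂ) (u ≫ π)) ⁻¹'
      {Q : ComplexPoints P | Q.pt ∈ V x}) ≃ₜ ↥{Q : ComplexPoints P | Q.pt ∈ V x} × (Fin 1 → ℂ),
      ∀ y, ((φ y).1 : ComplexPoints P) = AlgPoints.mapContinuous (L := ℂ) (u ≫ π) y := fun x ↦ by
    obtain ⟨ε, hε⟩ := exists_iso_prod_affineSpace_of_polynomial_chart (u ≫ π) (V x) (hV x) (hO x)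
      (ech x) (hech x)
    exact exists_trivialisation_of_iso_prod_affineSpace (u ≫ π) (V x) ε hε
  choose φ hφ using hφ
  exact exists_restrictCompl_sub_map_eq_zero_of_trivial_affine_complement π σ u hu
    (fun x : P.left ↦ {Q : ComplexPoints P | Q.pt ∈ V x}) hUo hU φ hφ a e

end Complement

end Literature.AlgebraicGeometry.HodgeTheory

end
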